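import Literature.Analysis.FluidPDE.ElgindiAngularGreenKernel
import Mathlib.MeasureTheory.Integral.IntervalIntegral.FundThmCalculus
import Mathlib.MeasureTheory.Integral.DominatedConvergence
import Mathlib.Analysis.Real.Pi.Bounds
import HarnessLib

/-!
# The Green's operator of the angular problem of Elgindi's polar elliptic operator
([Elgindi2021] §8.3 Proposition 8.13: "We do this by directly solving the above equation")

Topic `Literature/Analysis/FluidPDE`. Support file (definitions with bodies and proved theorems, no
named facts) on the proof path of the named fact
`Literature.Analysis.FluidPDE.Elgindi.ElgindiGhoulMasmoudi2021_stabilityCore`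
(`ElgindiStabilityDecomposition.lean`). T. M. Elgindi, Ann. of Math. 194 (2021) =
arXiv:1904.04795, §8.3 Proposition 8.13 (p. 27): the angular equation
`∂_θθΦ̃ − ∂_θ(tan θ Φ̃) = Γ` is solved by quadratures, "`C₁` is now chosen to keep the boundary
condition `Φ̃(π/2) = 0`". Here the full angular operator `L_θ = −∂_θθ + ∂_θ(tan θ·) − 6` is
inverted on data `cos²θ·h` by variation of parameters with the fundamental solutions of
`ElgindiAngularGreenKernel.lean` (in the variable `χ`, `Φ = cos θ·χ`,
`−(cos³θχ′)′ − 4cos³θχ = cos²θ·h`):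

`𝒦h(θ) = sin θ·∫₀^θ k₂h + u₂(θ)·∫_θ^{π/2} sin β cos²β·h(β) dβ` (`greenOp`),

for `h` continuous on `[0, π/2]`. Proved: `𝒦h` solves the equation in flux form on `(0, π/2)`
(`hasDerivAt_greenOp`, `hasDerivAt_greenFlux`: `(cos³θ(𝒦h)′)′ = −4cos³θ·𝒦h − cos²θ·h`, the
derivative `(𝒦h)′ = cos θ·I₁ + (v₂/cos³θ)·I₂` with the variation-of-parameters cancellation and
the Wronskian jump); the bounds `|𝒦h| ≤ 10B`, `|cos θ·(𝒦h)′| ≤ 10B` from `|h| ≤ B`; the boundary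
values `𝒦h(0) = −∫₀^{π/2} sin β cos²β h` (so `Φ(0) = 0` iff `h ⊥ sin θ cos²θ`, the adjoint kernel)
and `cos θ·𝒦h(θ) → 0` at `π/2` (`|u₂I₂| ≤ (5/3)B cos θ`); continuity of `𝒦h` on `[0, π/2]`. This
is the `μ = 0` resolvent used to build the angular corrector of the profile `Φ_*` by a contraction.
-/

noncomputable section

open Set Real Filter MeasureTheory intervalIntegral
open _root_.Topology

namespace Literature.Analysis.FluidPDE

namespace Elgindi

/-! ### The two primitives and the operator -/

/-- `I₁(h)(θ) = ∫₀^θ k₂(β)h(β) dβ`. [folklore] -/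
def greenI1 (h : ℝ → ℝ) (θ : ℝ) : ℝ := ∫ β in (0:ℝ)..θ, greenK2 β * h β

/-- `I₂(h)(θ) = ∫_θ^{π/2} sin β cos²β·h(β) dβ` (the moment against the adjoint kernel
`K₀ = sin θ cos²θ`). [folklore] -/
def greenI2 (h : ℝ → ℝ) (θ : ℝ) : ℝ := ∫ β in θ..(π / 2), Real.sin β * Real.cos β ^ 2 * h β

/-- **The Green's operator `𝒦h = sin θ·I₁(h) + u₂·I₂(h)`** of `−(cos³θχ′)′ − 4cos³θχ = cos²θ·h`. [cite: Elgindi2021, §8.3 proof of Proposition 8.13 (p. 27 of arXiv:1904.04795): solution of the angular equation by quadratures] -/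
def greenOp (h : ℝ → ℝ) (θ : ℝ) : ℝ := Real.sin θ * greenI1 h θ + greenU2 θ * greenI2 h θ

/-- `|k₂| ≤ 5` on the closed interval `[0, π/2]`. [folklore] -/
theorem abs_greenK2_le_Icc {θ : ℝ} (hθ : θ ∈ Icc 0 (π / 2)) : |greenK2 θ| ≤ 5 := by
  rcases eq_or_lt_of_le hθ.2 with heq | hlt
  · rw [heq, greenK2_pi_div_two]; norm_num
  · exact abs_greenK2_le ⟨hθ.1, hlt⟩

/-- `∫_θ^{π/2} sin β cos²β dβ = cos³θ/3`. [folklore] -/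
theorem integral_sin_mul_cos_sq (θ : ℝ) : ∫ β in θ..(π / 2), Real.sin β * Real.cos β ^ 2 = Real.cos θ ^ 3 / 3 := by
  have hd : ∀ x ∈ uIcc θ (π / 2), HasDerivAt (fun β => -(Real.cos β ^ 3 / 3)) (Real.sin x * Real.cos x ^ 2) x := by
    intro x _
    have h := (((Real.hasDerivAt_cos x).fun_pow 3).div_const 3).neg
    refine h.congr_deriv ?_
    push_cast; ring
  rw [integral_eq_sub_of_hasDerivAt hd (by apply Continuous.intervalIntegrable; fun_prop), Real.cos_pi_div_two]
  ring

/-- `0 ∈ [0, π/2]`. [folklore] -/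
private theorem zero_mem_Icc' : (0:ℝ) ∈ Icc 0 (π / 2) := ⟨le_rfl, by positivity⟩
/-- `π/2 ∈ [0, π/2]`. [folklore] -/
private theorem pi_div_two_mem_Icc' : π / 2 ∈ Icc 0 (π / 2) := ⟨by positivity, le_rfl⟩

section operator

variable {h : ℝ → ℝ} (hc : ContinuousOn h (Icc 0 (π / 2))) {B : ℝ} (hB : ∀ θ ∈ Icc 0 (π / 2), |h θ| ≤ B)
include hc

/-! ### Integrability and the fundamental theorem of calculus -/

/-- The integrand `k₂h` is continuous on `[0, π/2]`. [folklore] -/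
theorem continuousOn_greenK2_mul : ContinuousOn (fun β => greenK2 β * h β) (Icc 0 (π / 2)) :=
  continuousOn_greenK2_Icc.mul hc

/-- The integrand `sin β cos²β·h` is continuous on `[0, π/2]`. [folklore] -/
theorem continuousOn_K0_mul : ContinuousOn (fun β => Real.sin β * Real.cos β ^ 2 * h β) (Icc 0 (π / 2)) :=
  (Continuous.continuousOn (by fun_prop)).mul hc

/-- Interval integrability of `k₂h` between points of `[0, π/2]`. [folklore] -/
theorem intervalIntegrable_greenK2_mul {a b : ℝ} (ha : a ∈ Icc 0 (π / 2)) (hb : b ∈ Icc 0 (π / 2)) :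
    IntervalIntegrable (fun β => greenK2 β * h β) volume a b :=
  ((continuousOn_greenK2_mul hc).mono (uIcc_subset_Icc ha hb)).intervalIntegrable

/-- Interval integrability of `sin β cos²β·h` between points of `[0, π/2]`. [folklore] -/
theorem intervalIntegrable_K0_mul {a b : ℝ} (ha : a ∈ Icc 0 (π / 2)) (hb : b ∈ Icc 0 (π / 2)) :
    IntervalIntegrable (fun β => Real.sin β * Real.cos β ^ 2 * h β) volume a b :=
  ((continuousOn_K0_mul hc).mono (uIcc_subset_Icc ha hb)).intervalIntegrable

/-- **FTC for `I₁`**: `I₁′ = k₂h` on `(0, π/2)`. [folklore] -/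
theorem hasDerivAt_greenI1 {θ : ℝ} (hθ : θ ∈ Ioo 0 (π / 2)) : HasDerivAt (greenI1 h) (greenK2 θ * h θ) θ := by
  have hθc : θ ∈ Icc 0 (π / 2) := Ioo_subset_Icc_self hθ
  have hco : ContinuousOn (fun β => greenK2 β * h β) (Ioo 0 (π / 2)) := (continuousOn_greenK2_mul hc).mono Ioo_subset_Icc_self
  have hat : ContinuousAt (fun β => greenK2 β * h β) θ := (continuousOn_greenK2_mul hc).continuousAt (Icc_mem_nhds hθ.1 hθ.2)
  exact integral_hasDerivAt_right (intervalIntegrable_greenK2_mul hc zero_mem_Icc' hθc)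
    (hco.stronglyMeasurableAtFilter isOpen_Ioo θ hθ) hat

/-- **FTC for `I₂`**: `I₂′ = −sin θ cos²θ·h` on `(0, π/2)`. [folklore] -/
theorem hasDerivAt_greenI2 {θ : ℝ} (hθ : θ ∈ Ioo 0 (π / 2)) : HasDerivAt (greenI2 h) (-(Real.sin θ * Real.cos θ ^ 2 * h θ)) θ := by
  have hθc : θ ∈ Icc 0 (π / 2) := Ioo_subset_Icc_self hθ
  have hco : ContinuousOn (fun β => Real.sin β * Real.cos β ^ 2 * h β) (Ioo 0 (π / 2)) := (continuousOn_K0_mul hc).mono Ioo_subset_Icc_self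
  have hat : ContinuousAt (fun β => Real.sin β * Real.cos β ^ 2 * h β) θ := (continuousOn_K0_mul hc).continuousAt (Icc_mem_nhds hθ.1 hθ.2)
  exact integral_hasDerivAt_left (intervalIntegrable_K0_mul hc hθc pi_div_two_mem_Icc')
    (hco.stronglyMeasurableAtFilter isOpen_Ioo θ hθ) hat

/-- **`(𝒦h)′ = cos θ·I₁ + (v₂/cos³θ)·I₂`** on `(0, π/2)` — the terms `h(sin θ k₂ − u₂ sin θ cos²θ)`
cancel (variation of parameters). [cite: Elgindi2021, §8.3 proof of Proposition 8.13 (p. 27 of arXiv:1904.04795)] -/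
theorem hasDerivAt_greenOp {θ : ℝ} (hθ : θ ∈ Ioo 0 (π / 2)) :
    HasDerivAt (greenOp h) (Real.cos θ * greenI1 h θ + greenV2 θ / Real.cos θ ^ 3 * greenI2 h θ) θ := by
  have hθ' : θ ∈ Ioo (-(π / 2)) (π / 2) := ⟨by linarith [hθ.1, Real.pi_pos], hθ.2⟩
  have hc0 : Real.cos θ ≠ 0 := (Real.cos_pos_of_mem_Ioo hθ').ne'
  have h1 := (Real.hasDerivAt_sin θ).fun_mul (hasDerivAt_greenI1 hc hθ)
  have h2 := (hasDerivAt_greenU2 hθ').fun_mul (hasDerivAt_greenI2 hc hθ)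
  have hD := h1.fun_add h2
  unfold greenOp
  refine hD.congr_deriv ?_
  have hk := greenU2_mul_cos_sq hc0
  linear_combination (-(Real.sin θ * h θ)) * hk

/-! ### The equation in flux form -/

omit hc in
/-- `cos³θ·(𝒦h)′ = cos⁴θ·I₁ + v₂·I₂` (the flux). [folklore] -/
theorem cos_pow_three_mul_deriv_greenOp {θ : ℝ} (hθ : θ ∈ Ioo 0 (π / 2)) :
    Real.cos θ ^ 3 * (Real.cos θ * greenI1 h θ + greenV2 θ / Real.cos θ ^ 3 * greenI2 h θ) =
      Real.cos θ ^ 4 * greenI1 h θ + greenV2 θ * greenI2 h θ := by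
  have hc0 : Real.cos θ ≠ 0 := (Real.cos_pos_of_mem_Ioo ⟨by linarith [hθ.1, Real.pi_pos], hθ.2⟩).ne'
  field_simp

/-- **The flux equation `(cos⁴θ·I₁ + v₂·I₂)′ = −4cos³θ·𝒦h − cos²θ·h`** on `(0, π/2)`, i.e.
`−(cos³θ(𝒦h)′)′ − 4cos³θ(𝒦h) = cos²θ·h` (the Wronskian gives the jump `−cos²θ`). [cite: Elgindi2021, §8.3 proof of Proposition 8.13 (p. 27 of arXiv:1904.04795)] -/
theorem hasDerivAt_greenFlux {θ : ℝ} (hθ : θ ∈ Ioo 0 (π / 2)) :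
    HasDerivAt (fun θ' => Real.cos θ' ^ 4 * greenI1 h θ' + greenV2 θ' * greenI2 h θ')
      (-4 * Real.cos θ ^ 3 * greenOp h θ - Real.cos θ ^ 2 * h θ) θ := by
  have hθ' : θ ∈ Ioo (-(π / 2)) (π / 2) := ⟨by linarith [hθ.1, Real.pi_pos], hθ.2⟩
  have hc0 : Real.cos θ ≠ 0 := (Real.cos_pos_of_mem_Ioo hθ').ne'
  have h1 := ((Real.hasDerivAt_cos θ).fun_pow 4).fun_mul (hasDerivAt_greenI1 hc hθ)
  have h2 := (hasDerivAt_greenV2 hθ').fun_mul (hasDerivAt_greenI2 hc hθ)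
  have hD := h1.fun_add h2
  refine hD.congr_deriv ?_
  have W := greenK2_wronskian θ
  have hk := greenU2_mul_cos_sq hc0
  unfold greenOp
  push_cast
  linear_combination (h θ) * W + (4 * Real.cos θ * greenI2 h θ) * hk

/-! ### Bounds -/

section bounds

include hB

omit hc in
/-- `0 ≤ B` (the bound of `|h|` at `θ = 0`). [folklore] -/
private theorem bound_nonneg : 0 ≤ B := (abs_nonneg _).trans (hB 0 ⟨le_rfl, by positivity⟩)

omit hc in
/-- **`|I₁(θ)| ≤ 5Bθ`** on `[0, π/2]`. [folklore] -/
theorem abs_greenI1_le {θ : ℝ} (hθ : θ ∈ Icc 0 (π / 2)) : |greenI1 h θ| ≤ 5 * B * θ := by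
  have hB0 := bound_nonneg hB
  have h := norm_integral_le_of_norm_le_const (a := 0) (b := θ) (C := 5 * B) (f := fun β => greenK2 β * h β) fun x hx => by
    rw [uIoc_of_le hθ.1] at hx
    have hx' : x ∈ Icc 0 (π / 2) := ⟨hx.1.le, hx.2.trans hθ.2⟩
    rw [Real.norm_eq_abs, abs_mul]
    exact mul_le_mul (abs_greenK2_le_Icc hx') (hB x hx') (abs_nonneg _) (by norm_num)
  rw [Real.norm_eq_abs, sub_zero, abs_of_nonneg hθ.1] at h
  exact h

/-- **`|I₂(θ)| ≤ B·cos³θ/3`** on `[0, π/2]`. [folklore] -/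
theorem abs_greenI2_le {θ : ℝ} (hθ : θ ∈ Icc 0 (π / 2)) : |greenI2 h θ| ≤ B * (Real.cos θ ^ 3 / 3) := by
  have hB0 := bound_nonneg hB
  unfold greenI2
  have hK0 : ∀ x ∈ Icc θ (π / 2), 0 ≤ Real.sin x * Real.cos x ^ 2 := fun x hx =>
    mul_nonneg (Real.sin_nonneg_of_nonneg_of_le_pi (hθ.1.trans hx.1) (by linarith [hx.2, Real.pi_pos])) (sq_nonneg _)
  have hle : ∀ x ∈ Icc θ (π / 2), |Real.sin x * Real.cos x ^ 2 * h x| ≤ B * (Real.sin x * Real.cos x ^ 2) := by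
    intro x hx
    rw [abs_mul, abs_of_nonneg (hK0 x hx), mul_comm]
    exact mul_le_mul_of_nonneg_right (hB x ⟨hθ.1.trans hx.1, hx.2⟩) (hK0 x hx)
  calc |∫ β in θ..(π / 2), Real.sin β * Real.cos β ^ 2 * h β|
      ≤ ∫ β in θ..(π / 2), |Real.sin β * Real.cos β ^ 2 * h β| := abs_integral_le_integral_abs hθ.2
    _ ≤ ∫ β in θ..(π / 2), B * (Real.sin β * Real.cos β ^ 2) := by
        refine integral_mono_on hθ.2 ?_ (by apply Continuous.intervalIntegrable; fun_prop) hle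
        exact ((continuousOn_K0_mul hc).mono (Icc_subset_Icc hθ.1 le_rfl)).norm.intervalIntegrable_of_Icc hθ.2
    _ = B * (Real.cos θ ^ 3 / 3) := by rw [intervalIntegral.integral_const_mul, integral_sin_mul_cos_sq]

/-- **`|u₂(θ)·I₂(θ)| ≤ (5/3)B·cos θ`** on `[0, π/2]`: the singular factor `u₂ ~ 1/(2cos²θ)` is
tamed by `I₂ = O(cos³θ)`; in particular `cos θ·𝒦h(θ) → 0` at `π/2`. [folklore] -/
theorem abs_greenU2_mul_greenI2_le {θ : ℝ} (hθ : θ ∈ Icc 0 (π / 2)) : |greenU2 θ * greenI2 h θ| ≤ 5 / 3 * B * Real.cos θ := by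
  have hB0 := bound_nonneg hB
  rcases eq_or_lt_of_le hθ.2 with heq | hlt
  · rw [heq]
    unfold greenI2
    rw [intervalIntegral.integral_same, mul_zero, abs_zero, Real.cos_pi_div_two, mul_zero]
  · have hθ' : θ ∈ Ico 0 (π / 2) := ⟨hθ.1, hlt⟩
    have hc0 : 0 < Real.cos θ := Real.cos_pos_of_mem_Ioo ⟨by linarith [hθ.1, Real.pi_pos], hlt⟩
    have h1 := abs_greenU2_mul_cos_sq_le hθ'
    have h2 := abs_greenI2_le hc hB hθ
    have hu : |greenU2 θ| ≤ 5 / Real.cos θ ^ 2 := by rw [le_div_iff₀ (by positivity)]; exact h1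
    rw [abs_mul]
    calc |greenU2 θ| * |greenI2 h θ| ≤ (5 / Real.cos θ ^ 2) * (B * (Real.cos θ ^ 3 / 3)) :=
          mul_le_mul hu h2 (abs_nonneg _) (by positivity)
      _ = 5 / 3 * B * Real.cos θ := by field_simp

/-- **`|𝒦h| ≤ 10B`** on `[0, π/2]`. [folklore] -/
theorem abs_greenOp_le {θ : ℝ} (hθ : θ ∈ Icc 0 (π / 2)) : |greenOp h θ| ≤ 10 * B := by
  have hB0 := bound_nonneg hB
  have h1 := abs_greenI1_le hB hθ
  have h2 := abs_greenU2_mul_greenI2_le hc hB hθ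
  have hπ : π / 2 ≤ 1.6 := by have := Real.pi_lt_d2; linarith
  have hs : |Real.sin θ| ≤ 1 := Real.abs_sin_le_one θ
  have hc1 : Real.cos θ ≤ 1 := Real.cos_le_one θ
  unfold greenOp
  calc |Real.sin θ * greenI1 h θ + greenU2 θ * greenI2 h θ| ≤ |Real.sin θ| * |greenI1 h θ| + |greenU2 θ * greenI2 h θ| := by
        rw [← abs_mul]; exact abs_add_le _ _
    _ ≤ 1 * (5 * B * θ) + 5 / 3 * B * Real.cos θ := add_le_add (mul_le_mul hs h1 (abs_nonneg _) (by norm_num)) h2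
    _ ≤ 10 * B := by nlinarith [hθ.2, mul_nonneg hB0 (sub_nonneg.2 hc1), mul_nonneg hB0 (sub_nonneg.2 (hθ.2.trans hπ))]

/-- **`|cos θ·(𝒦h)′(θ)| ≤ 10B`** on `(0, π/2)` (`cos θ·(𝒦h)′ = cos²θ·I₁ + (v₂/cos²θ)·I₂`). [folklore] -/
theorem abs_cos_mul_deriv_greenOp_le {θ : ℝ} (hθ : θ ∈ Ioo 0 (π / 2)) :
    |Real.cos θ * (Real.cos θ * greenI1 h θ + greenV2 θ / Real.cos θ ^ 3 * greenI2 h θ)| ≤ 10 * B := by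
  have hB0 := bound_nonneg hB
  have hθc : θ ∈ Icc 0 (π / 2) := Ioo_subset_Icc_self hθ
  have hc0 : 0 < Real.cos θ := Real.cos_pos_of_mem_Ioo ⟨by linarith [hθ.1, Real.pi_pos], hθ.2⟩
  have hc1 : Real.cos θ ≤ 1 := Real.cos_le_one θ
  have h1 := abs_greenI1_le hB hθc
  have h2 := abs_greenI2_le hc hB hθc
  have hv := abs_greenV2_le ⟨hθ.1.le, hθ.2⟩
  have hπ : π / 2 ≤ 1.6 := by have := Real.pi_lt_d2; linarith
  have e : Real.cos θ * (Real.cos θ * greenI1 h θ + greenV2 θ / Real.cos θ ^ 3 * greenI2 h θ) =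
      Real.cos θ ^ 2 * greenI1 h θ + greenV2 θ * (greenI2 h θ / Real.cos θ ^ 2) := by
    field_simp
  rw [e]
  have hI2 : |greenI2 h θ / Real.cos θ ^ 2| ≤ B * Real.cos θ / 3 := by
    rw [abs_div, abs_of_pos (by positivity : (0:ℝ) < Real.cos θ ^ 2), div_le_iff₀ (by positivity)]
    calc |greenI2 h θ| ≤ B * (Real.cos θ ^ 3 / 3) := h2
      _ = B * Real.cos θ / 3 * Real.cos θ ^ 2 := by ring
  calc |Real.cos θ ^ 2 * greenI1 h θ + greenV2 θ * (greenI2 h θ / Real.cos θ ^ 2)|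
      ≤ |Real.cos θ ^ 2| * |greenI1 h θ| + |greenV2 θ| * |greenI2 h θ / Real.cos θ ^ 2| := by
        rw [← abs_mul, ← abs_mul]; exact abs_add_le _ _
    _ ≤ 1 * (5 * B * θ) + 6 * (B * Real.cos θ / 3) := by
        refine add_le_add (mul_le_mul ?_ h1 (abs_nonneg _) (by norm_num)) (mul_le_mul hv hI2 (abs_nonneg _) (by norm_num))
        rw [abs_of_nonneg (sq_nonneg _)]; nlinarith
    _ ≤ 10 * B := by nlinarith [hθc.2, mul_nonneg hB0 (sub_nonneg.2 hc1), mul_nonneg hB0 (sub_nonneg.2 (hθc.2.trans hπ))]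

end bounds

/-! ### Boundary values and continuity -/

omit hc in
/-- **`𝒦h(0) = −∫₀^{π/2} sin β cos²β·h`**: the boundary value at `θ = 0` is minus the moment of
`h` against the adjoint kernel; it vanishes iff `h ⊥ sin θ cos²θ`. [folklore] -/
theorem greenOp_zero : greenOp h 0 = -greenI2 h 0 := by
  simp [greenOp, greenI1, greenU2_zero]

omit hc in
/-- `𝒦h(π/2) = I₁(π/2)` (the moment term vanishes at `π/2`). [folklore] -/
theorem greenOp_pi_div_two : greenOp h (π / 2) = greenI1 h (π / 2) := by
  simp [greenOp, greenI2]

/-- `I₁` is continuous on `[0, π/2]`. [folklore] -/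
theorem continuousOn_greenI1 : ContinuousOn (greenI1 h) (Icc 0 (π / 2)) := by
  have hint : IntegrableOn (fun β => greenK2 β * h β) (uIcc 0 (π / 2)) volume := by
    rw [uIcc_of_le (by positivity : (0:ℝ) ≤ π / 2)]
    exact (continuousOn_greenK2_mul hc).integrableOn_Icc
  have h := intervalIntegral.continuousOn_primitive_interval hint
  rw [uIcc_of_le (by positivity : (0:ℝ) ≤ π / 2)] at h
  exact h

/-- `I₂` is continuous on `[0, π/2]`. [folklore] -/
theorem continuousOn_greenI2 : ContinuousOn (greenI2 h) (Icc 0 (π / 2)) := by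
  have hint : IntegrableOn (fun β => Real.sin β * Real.cos β ^ 2 * h β) (uIcc 0 (π / 2)) volume := by
    rw [uIcc_of_le (by positivity : (0:ℝ) ≤ π / 2)]
    exact (continuousOn_K0_mul hc).integrableOn_Icc
  have h := intervalIntegral.continuousOn_primitive_interval_left hint
  rw [uIcc_of_le (by positivity : (0:ℝ) ≤ π / 2)] at h
  exact h

include hB in
/-- **`𝒦h` is continuous on `[0, π/2]`** (at `π/2` by the squeeze `|u₂I₂| ≤ (5/3)B cos θ`). [folklore] -/
theorem continuousOn_greenOp : ContinuousOn (greenOp h) (Icc 0 (π / 2)) := by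
  have hI1 := continuousOn_greenI1 hc
  have hI2 := continuousOn_greenI2 hc
  have hsin : ContinuousOn (fun θ => Real.sin θ * greenI1 h θ) (Icc 0 (π / 2)) := Real.continuous_sin.continuousOn.mul hI1
  -- the singular product `u₂I₂`
  have hprod : ContinuousOn (fun θ => greenU2 θ * greenI2 h θ) (Icc 0 (π / 2)) := by
    intro θ hθ
    rcases eq_or_lt_of_le hθ.2 with heq | hlt
    · subst heq
      have hval : greenU2 (π / 2) * greenI2 h (π / 2) = 0 := by simp [greenI2]
      rw [ContinuousWithinAt, hval]
      have hB0 := bound_nonneg hB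
      have hup : Tendsto (fun θ' : ℝ => 5 / 3 * B * Real.cos θ') (𝓝[Icc 0 (π / 2)] (π / 2)) (𝓝 0) := by
        have : Tendsto (fun θ' : ℝ => 5 / 3 * B * Real.cos θ') (𝓝 (π / 2)) (𝓝 (5 / 3 * B * Real.cos (π / 2))) :=
          ((Real.continuous_cos.const_mul (5 / 3 * B)).tendsto _)
        rw [Real.cos_pi_div_two, mul_zero] at this
        exact this.mono_left nhdsWithin_le_nhds
      have hlow : Tendsto (fun θ' : ℝ => -(5 / 3 * B * Real.cos θ')) (𝓝[Icc 0 (π / 2)] (π / 2)) (𝓝 0) := by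
        simpa using hup.neg
      refine tendsto_of_tendsto_of_tendsto_of_le_of_le' hlow hup ?_ ?_
      · exact eventually_nhdsWithin_of_forall fun θ' hθ' => (abs_le.1 (abs_greenU2_mul_greenI2_le hc hB hθ')).1
      · exact eventually_nhdsWithin_of_forall fun θ' hθ' => (abs_le.1 (abs_greenU2_mul_greenI2_le hc hB hθ')).2
    · have hθ' : θ ∈ Ioo (-(π / 2)) (π / 2) := ⟨by linarith [hθ.1, Real.pi_pos], hlt⟩
      have hu : ContinuousAt greenU2 θ := (hasDerivAt_greenU2 hθ').continuousAt
      exact hu.continuousWithinAt.mul (hI2 θ hθ)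
  have h := hsin.add hprod
  exact h.congr fun θ _ => rfl

end operator

end Elgindi

end Literature.Analysis.FluidPDE
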